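import Summits.NavierStokesRegularity.NavierStokesRegularity.Theses.ScaledTopAlignment
import Summits.NavierStokesRegularity.NavierStokesRegularity.Theses.RecurrentProfiles
import Summits.NavierStokesRegularity.NavierStokesRegularity.Theorems.ScaledTopAlignmentAprioriMostTimesBulkAlignmentOfRecurrentLiouville
import HarnessLib

/-!
# Line `recurrent` — crux stmt-NavierStokesRegularity-19551 `AprioriMostTimesBulkAlignment` (W3ᵐᵗ), route ScaledTopAlignment

Strategist line (unit ns-sta-19551-cstrat-1; g0 evidence #12 of 2026-08-26T14:58Z, re-issued by g2 against the current tree so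
that a hub-readable copy exists under `Cruxes/AprioriMostTimesBulkAlignment/Lines/`).  Lens: transfer (ω-limit normal form).

KERNEL LOCATION OF THE CRUX (landed, by name): `aprioriMostTimesBulkAlignment_iff_target_and_typeII` (p446918):
W3ᵐᵗ ↔ ThreadingFlux.Target (stmt-1217, «no Type-I blow-up for Clay data») ∧ R_II (the door's clause at solutions that neither
extend past `T` nor blow up at the Type-I rate).  The registry-of-record line (class-#2 cut) isolates the same content in its open
stub `stub_singularNearMaxCoherence` (`singularNearMaxCoherence_hardCore`, p450310: stub ⇒ Target, and NoTypeII → (stub ↔ Target)).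

THIS LINE does not look for an a-priori estimate.  It REDIRECTS the Type-I content to the recurrent Liouville theorem of route
RecurrentProfiles — `RecurrentLiouville` (stmt-1589): every uniformly-recurrent local-energy Type-I-rate profile is regular at the
space–time origin — which implies Target by the landed chain `threadingFluxTarget_of_recurrentLiouville` (p452625 ∘ items 1590/1591/1593,
all proved), and keeps the Type-II residue `R_II` verbatim as the second stub (vacuous under the route's residual NoTypeII:
`typeIIResidue_of_noTypeII`).  Composition = `aprioriMostTimesBulkAlignment_of_recurrentLiouville_of_typeIIResidue` (p452625), sorry-free;
skeleton theorem `aprioriMostTimesBulkAlignment_holds_of_stubs` (v2 2026-08-26 p3 g5: conditional duplicate removed, see the note in the body).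

Stubs (2): `stub_recurrentLiouville` = item stmt-1589 BY NAME (open; 1589 ⟺ RellichScar items 11716 ∧ 11719 by `recurrentLiouville_of_rellichScar`
/ `rellichScar_of_recurrentLiouville`, p128754 — RESEAT-GUARD on 1589: it moves only when 11716 or 11719 moves); `stub_typeIIResidue` = R_II verbatim
(not an item; discharged by the residual stmt-0056 through `typeIIResidue_of_noTypeII`, or by any a-priori proof of the door at non-Type-I blow-ups).
WHAT THIS IS NOT: not NS regularity, not a proof of either stub; a kernel-checked composition only.
-/

namespace Summit.NavierStokesRegularity.NavierStokesRegularity.Cruxes.AprioriMostTimesBulkAlignment.Recurrent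

open MeasureTheory Literature.Analysis.FluidPDE

/-- STUB 1 (hardest; = item stmt-NavierStokesRegularity-1589 BY NAME): the recurrent Liouville theorem of route RecurrentProfiles. -/
theorem stub_recurrentLiouville :
    Summit.NavierStokesRegularity.NavierStokesRegularity.Theses.RecurrentProfiles.RecurrentLiouville := by
  sorry

/-- STUB 2 (the Type-II residue `R_II` of the door, verbatim from `aprioriMostTimesBulkAlignment_iff_target_and_typeII`):
the W3ᵐᵗ clause at every classical Leray–Hopf solution from rapidly decaying data that neither extends past `T` nor blows up at
the Type-I rate.  Vacuously true under the route's residual `NoTypeII` (`typeIIResidue_of_noTypeII`). -/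
theorem stub_typeIIResidue :
    ∀ (ν T : ℝ), 0 < ν → 0 < T → ∀ (u : ℝ → EuclideanSpace ℝ (Fin 3) → EuclideanSpace ℝ (Fin 3))
        (p : ℝ → EuclideanSpace ℝ (Fin 3) → ℝ),
        IsClassicalNSSolutionOn (Set.Ico 0 T) ν 0 u p → IsLerayHopfOn T ν 0 (u 0) u →
        HasRapidSpatialDecay (u 0) → ¬ HasSmoothExtensionPast ν 0 u T → ¬ IsTypeIBlowup u T →
        ∃ lam0 : ℝ, lam0 < 1 ∧ ∃ R0 : ℝ, 0 < R0 ∧ ∃ θ : ℝ, θ < 1 ∧ ∀ κ : ℝ, 0 < κ → ∀ ε : ℝ, 0 < ε →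
          ∀ δ : ℝ, 0 < δ → ∃ M : ℝ, 0 < M ∧ ∃ E : Set ℝ,
            (∃ h0 : ℝ, 0 < h0 ∧ ∀ h : ℝ, 0 < h → h < h0 →
              volume (E ∩ Set.Ioo (T - h) T) ≤ ENNReal.ofReal (θ * h)) ∧
            ∀ t ∈ Set.Ico 0 T, t ∉ E → ∀ x : EuclideanSpace ℝ (Fin 3), M ≤ ‖curl (u t) x‖ →
              κ / (T - t) ≤ ‖curl (u t) x‖ →
              volume {y : EuclideanSpace ℝ (Fin 3) | lam0 * ‖curl (u t) x‖ ≤ ‖curl (u t) y‖ ∧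
                  ‖x - y‖ ≤ R0 * Real.sqrt (ν / ‖curl (u t) x‖) ∧
                  ε < Real.sqrt (1 - (inner ℝ (‖curl (u t) x‖⁻¹ • curl (u t) x)
                    (‖curl (u t) y‖⁻¹ • curl (u t) y)) ^ 2)}
                ≤ ENNReal.ofReal (δ * Real.sqrt (ν / ‖curl (u t) x‖) ^ 3) := by
  sorry

/- p3 g5 repair (2026-08-26, `skeleton.extra-hypothesis`): the former conditional composition
   `AprioriMostTimesBulkAlignment_of : RecurrentLiouville → R_II → AprioriMostTimesBulkAlignment := fun hL hR => …` was REMOVED from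
   this file — it is, verbatim, the landed theorem `Theorems.aprioriMostTimesBulkAlignment_of_recurrentLiouville_of_typeIIResidue`
   (p452625), and as a local crux-concluding theorem with an inline (un-named) `Prop` hypothesis it made the skeleton audit pick it
   and fail (ii).  The skeleton theorem is `aprioriMostTimesBulkAlignment_holds_of_stubs` below (stub-cone form, as in the
   registered `PoloidalWindowRigidity/Lines/slicesharp.lean`). -/

/-- SKELETON / COMPOSITION (sorry-free given the stubs; concludes the crux BY NAME): the two stubs give W3ᵐᵗ through the landed
bridge `aprioriMostTimesBulkAlignment_of_recurrentLiouville_of_typeIIResidue` (p452625).  The line closes the day both stubs close. -/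
theorem aprioriMostTimesBulkAlignment_holds_of_stubs :
    Summit.NavierStokesRegularity.NavierStokesRegularity.Theses.ScaledTopAlignment.AprioriMostTimesBulkAlignment :=
  Summit.NavierStokesRegularity.NavierStokesRegularity.Theorems.aprioriMostTimesBulkAlignment_of_recurrentLiouville_of_typeIIResidue
    stub_recurrentLiouville stub_typeIIResidue

/-- Side certificate (sorry-free): under the route's residual NoTypeII (stmt-0056) STUB 2 is discharged, so the line's open
content given the residual is exactly STUB 1 = stmt-1589. -/
theorem stub_typeIIResidue_of_noTypeII
    (hII : Summit.NavierStokesRegularity.NavierStokesRegularity.Theses.ScaledTopAlignment.NoTypeII) :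
    ∀ (ν T : ℝ), 0 < ν → 0 < T → ∀ (u : ℝ → EuclideanSpace ℝ (Fin 3) → EuclideanSpace ℝ (Fin 3))
        (p : ℝ → EuclideanSpace ℝ (Fin 3) → ℝ),
        IsClassicalNSSolutionOn (Set.Ico 0 T) ν 0 u p → IsLerayHopfOn T ν 0 (u 0) u →
        HasRapidSpatialDecay (u 0) → ¬ HasSmoothExtensionPast ν 0 u T → ¬ IsTypeIBlowup u T →
        ∃ lam0 : ℝ, lam0 < 1 ∧ ∃ R0 : ℝ, 0 < R0 ∧ ∃ θ : ℝ, θ < 1 ∧ ∀ κ : ℝ, 0 < κ → ∀ ε : ℝ, 0 < ε →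
          ∀ δ : ℝ, 0 < δ → ∃ M : ℝ, 0 < M ∧ ∃ E : Set ℝ,
            (∃ h0 : ℝ, 0 < h0 ∧ ∀ h : ℝ, 0 < h → h < h0 →
              volume (E ∩ Set.Ioo (T - h) T) ≤ ENNReal.ofReal (θ * h)) ∧
            ∀ t ∈ Set.Ico 0 T, t ∉ E → ∀ x : EuclideanSpace ℝ (Fin 3), M ≤ ‖curl (u t) x‖ →
              κ / (T - t) ≤ ‖curl (u t) x‖ →
              volume {y : EuclideanSpace ℝ (Fin 3) | lam0 * ‖curl (u t) x‖ ≤ ‖curl (u t) y‖ ∧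
                  ‖x - y‖ ≤ R0 * Real.sqrt (ν / ‖curl (u t) x‖) ∧
                  ε < Real.sqrt (1 - (inner ℝ (‖curl (u t) x‖⁻¹ • curl (u t) x)
                    (‖curl (u t) y‖⁻¹ • curl (u t) y)) ^ 2)}
                ≤ ENNReal.ofReal (δ * Real.sqrt (ν / ‖curl (u t) x‖) ^ 3) :=
  Summit.NavierStokesRegularity.NavierStokesRegularity.Theorems.typeIIResidue_of_noTypeII hII

/-- Side certificate (sorry-free): STUB 1 alone already gives the hard core Target (stmt-1217) and, with the residual, Clay (A). -/
theorem target_of_stub1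
    (hL : Summit.NavierStokesRegularity.NavierStokesRegularity.Theses.RecurrentProfiles.RecurrentLiouville) :
    Summit.NavierStokesRegularity.NavierStokesRegularity.Theses.ThreadingFlux.Target :=
  Summit.NavierStokesRegularity.NavierStokesRegularity.Theorems.threadingFluxTarget_of_recurrentLiouville hL

theorem navierStokesRegularity_of_stub1_of_noTypeII
    (hL : Summit.NavierStokesRegularity.NavierStokesRegularity.Theses.RecurrentProfiles.RecurrentLiouville)
    (hII : Summit.NavierStokesRegularity.NavierStokesRegularity.Theses.ScaledTopAlignment.NoTypeII) :
    _root_.NavierStokesRegularity :=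
  Summit.NavierStokesRegularity.NavierStokesRegularity.Theorems.navierStokesRegularity_of_recurrentLiouville_of_noTypeII hL hII

end Summit.NavierStokesRegularity.NavierStokesRegularity.Cruxes.AprioriMostTimesBulkAlignment.Recurrent
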